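import Summits.ABC.ABC.Theses.DefiniteXi
import Summits.ABC.ABC.Theorems.DefiniteXiDefiniteRTControlPrime
import Summits.ABC.ABC.Theorems.DefiniteXiFreyModularity
import Summits.ABC.ABC.Theorems.DefiniteXiDefiniteRTControlPrimeSmulTransportDeg
import Summits.ABC.ABC.Theorems.DefiniteXiDefiniteRTControlPrimeValTransport
import Summits.ABC.ABC.Theorems.DefiniteXiDefiniteRTControlPrimeFreyScale
import Summits.ABC.ABC.Theorems.DefiniteXiDefiniteRTControlPrimeFreyLocal
import Summits.ABC.ABC.Theorems.IsogenyGlueCongruenceMazurKenkuBoundOfRadius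
import Literature.NumberTheory.EllipticCurves.TakahashiDegreeFormulaCoprimeProofs
import Literature.NumberTheory.EllipticCurves.PastenSpectralDegree
import Literature.NumberTheory.EllipticCurves.PastenHeightBounds
import Literature.NumberTheory.EllipticCurves.PastenHeightBoundsLemma68LocalProofs
import Literature.NumberTheory.EllipticCurves.PastenSpectralDegreeIsogenyBoundProofs
import Literature.NumberTheory.EllipticCurves.IsogenyDegreeLatticeIndexProofs
import Literature.NumberTheory.EllipticCurves.LatticeInclusionIsogenyComplexPointsProofs
import Literature.NumberTheory.EllipticCurves.ModularCurveManinSemistableBridgeProofs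
import Literature.NumberTheory.EllipticCurves.IsogenyConductorModularityProofs
import Literature.NumberTheory.EllipticCurves.ModularDegreeMinimal
import Literature.NumberTheory.EllipticCurves.IsogenyVariableChangeProofs
import Literature.NumberTheory.EllipticCurves.IsogenyCompProofs
import Literature.NumberTheory.EllipticCurves.IsogenyDualProofs
import Literature.NumberTheory.EllipticCurves.IsogenyIdProofs
import Literature.NumberTheory.EllipticCurves.RationalIsogenyDegreesProofs
import Literature.NumberTheory.Automorphic.ShimuraCurveRibetTakahashiComponentOrders
import Literature.NumberTheory.DiophantineGeometry.MinimalDiscriminantFactorizationProofs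
import HarnessLib

/-!
# Stub ideas k2 (gen 7, family RESHAPE) — `stub_pastenLemma68 : PastenShimura2024_lemma_6_8`
(crux `DefiniteRTControlPrime`, stmt-ABC-11338, route `DefiniteXi`, skeleton `Lines/Sketch.lean`).

**Gen 7 = NECESSITY of the gen-6 leaf.**  Gen 6 (`StubIdeasK2G6PastenLemma68.lean`, this
directory, `lean check` rc 0) typed the weighted one-isogeny leaf **W0**
`FreyWeightedTransportSubpoly` and PROVED `W0 → Takahashi 2.3 → DefiniteRTControlPrime`
(`definiteRTControlPrime_of_weightedTransportSubpoly`, `C(ε) = 4 (R_ε + 1)`).  This file proves the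
converse direction **N1**:

  `DefiniteRTControlPrime → Takahashi 2.3 (equality form) → F → I(B) → FreyModularity → W0`,
  with `R(ε) = max C(ε) 0 · B²`,

where F (`OptimalFactorizationLe`, Pasten 2024 §3 p. 13: `φ_E` factors through the optimal quotient,
`deg φ_E = deg(A_{1,N} → E) · δ_{1,N}`) is PROVED here in the tree's lattice model granted BCDT
(`optimalFactorizationLe_of_modularity`; modularity is used only for "isogenous ⇒ same conductor"),
and I(B) (`TakahashiIndexBound B`: Takahashi's image index `i_r = # im(Φ_r(J₀(N)) → Φ_r(E⋆)) ≤ B`;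
Pasten 2024 Lemma 6.14 p. 23: `i_r ∣ κ_S`, `S = {2}` for Frey curves; uniformly
`i_r ∣ #E'(ℚ)_tors ≤ 16` by Ribet's Eisenstein property + Katz 1981 Thm. 2 + Mazur 1977) is the
one remaining hypothesis — the exact gap between the crux and W0.  So (N1′)
`BCDT → Takahashi 2.3 → I(B) → (DefiniteRTControlPrime → W0)`.  The chain, at one `(a, b, q)`
with pivot `(W⋆, P⋆)`:
`ξ · c_q(W⋆) = δ⋆ · i⋆²` (Takahashi, `xi_mul_eq_modularDegree_mul_sq`), `deg φ · δ⋆ ≤ deg D_min(E)`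
(F), `deg D_min(E) ≤ C N^ε ξ c_q(E)` (the crux), `i⋆ ≤ B` (I), `ξ > 0` (`brandtXi_pos`) ⟹
`deg φ · c_q(W⋆) ≤ C B² N^ε c_q(E)`.

Upshot (the gen-7 reformulation): **modulo Takahashi 2.3 and the bounded Eisenstein index, the
crux `DefiniteRTControlPrime` IS the isogeny-only statement W0** — its entire non-Takahashi content
is one number per `(a, b, q)`, the `q`-toric index `b_q` of the cyclic isogeny `E_(a,b) → W⋆`
(gen 6, X: `deg φ · c_q(W⋆) = b² r · c_q(E)`).  Every supplier of the verbatim stub (Lemma 6.8 ⇐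
Mazur–Kenku, stmt-ABC-15193) is a supplier of W0, never conversely.
-/

set_option linter.dupNamespace false

noncomputable section

open scoped Classical MatrixGroups ModularForm
open CongruenceSubgroup UpperHalfPlane
open WeierstrassCurve IsDedekindDomain NumberField
open Literature.NumberTheory.EllipticCurves Literature.NumberTheory.EllipticCurves.ModularForms
open Literature.NumberTheory.DiophantineGeometry
open Literature.NumberTheory.Automorphic
open Summit.ABC.ABC.Theorems Summit.ABC.ABC.Theorems.DefiniteRTControlPrime
open Summit.ABC.ABC.Theses.DefiniteXi

namespace Summit.ABC.ABC.Cruxes.DefiniteRTControlPrime.StubIdeas2G7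

/-! ## 0. The leaf W0 (gen 6, verbatim — `Cruxes/…` modules are not importable) -/

/-- **W0** (gen 6 verbatim). Weighted one-isogeny transport to the Takahashi pivot: SOME
`ℚ`-isogeny `φ : E_(a,b) → W⋆` has `deg φ · v_q(Δ_min W⋆) ≤ R · N^ε · v_q(Δ_min E_(a,b))`.
[cite: PastenShimura2024, §3 p. 13 and Lemma 6.8 (p. 22)] [cite: Takahashi2001, Thm. 2.3] -/
def FreyWeightedTransportSubpoly : Prop :=
  ∀ ε : ℝ, 0 < ε → ∃ R : ℝ, ∀ (a b : ℤ), IsCoprime a b → a * b * (a + b) ≠ 0 →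
    ∀ (N : ℕ) [NeZero N], (freyCurve a b).conductorNorm ℤ = N →
    ∀ q : ℕ, q.Prime → q ≠ 2 → q ∣ N →
    ∀ (W' : WeierstrassCurve ℚ) [W'.IsElliptic] (P' : ModularParametrizationData W' N),
      W'.conductorNorm ℤ = N →
      (∀ (W'' : WeierstrassCurve ℚ) [W''.IsElliptic], W''.conductorNorm ℤ = N →
          ∀ P'' : ModularParametrizationData W'' N, P''.f = P'.f →
            P'.modularDegree ≤ P''.modularDegree) →
      (freyCurve a b).IsIsogenous W' →
        ∃ φ : Isogeny (freyCurve a b) W',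
          (φ.degree : ℝ) * ((W'.minimalDiscriminantNorm ℤ).factorization q : ℝ) ≤
            R * (N : ℝ) ^ ε * (((freyCurve a b).minimalDiscriminantNorm ℤ).factorization q : ℝ)

/-! ## 1. The two hypotheses of the necessity direction -/

/-- **F — factorisation through the optimal quotient, degree form (inequality).**  If `(W⋆, P⋆)`
is `X₀(N)`-optimal in Takahashi's sense (datum of minimal degree among level-`N` data of
conductor-`N` curves with the same newform) and `D` is ANY level-`N` datum of an isogenous model
`W` of conductor `N`, then some `ℚ`-isogeny `φ : W → W⋆` has `deg φ · deg P⋆ ≤ deg D` (in fact `=`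
for the dual of the lattice isogeny `z ↦ (c_D/c⋆) z : ℂ/Λ⋆ → ℂ/Λ_D`).  Pasten 2024, §3 p. 13:
"`φ_E` factors as `X₀(N) → A_{1,N} → E`", `deg φ_E = deg(A_{1,N} → E) · δ_{1,N}`.  Tree route to a
proof: `ModularParametrizationData.modularDegree_eq_card_ker_mul` (`deg D = [Λ_D : c_D Λ_f] · δ⋆`
on lattice-optimal raw data), `latticeEq_of_modularDegree_le` (minimal degree ⇒ `c⋆ Λ_f = Λ⋆`),
`exists_isogeny_degree_eq_relIndex_of_isNeronLatticeOf` (a `ℚ`-isogeny of degree `[Λ_D : cΛ⋆]`,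
Silverman AEC VI.4.1(b)), `natCard_ker_mulQuotientMap_eq_relIndex`, and a dual of equal degree;
the one non-lattice input is that the lattice-optimal curve `W₀ ∼ W⋆` has conductor `N`
(`conductorNorm_eq_of_isIsogenous_of_modularity`, granted BCDT, or `…_of_tate`).
[cite: PastenShimura2024, §3 (p. 13)] [cite: Knapp1993, Prop. 12.9(a) and p. 302]
[cite: SilvermanAEC2009, Thm. VI.4.1(b)] -/
def OptimalFactorizationLe : Prop :=
  ∀ (N : ℕ) [NeZero N] (W W' : WeierstrassCurve ℚ) [W.IsElliptic] [W'.IsElliptic]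
    (D : ModularParametrizationData W N) (P' : ModularParametrizationData W' N),
    W.conductorNorm ℤ = N → W'.conductorNorm ℤ = N → W.IsIsogenous W' →
    (∀ (W'' : WeierstrassCurve ℚ) [W''.IsElliptic], W''.conductorNorm ℤ = N →
        ∀ P'' : ModularParametrizationData W'' N, P''.f = P'.f →
          P'.modularDegree ≤ P''.modularDegree) →
      ∃ φ : Isogeny W W', φ.degree * P'.modularDegree ≤ D.modularDegree

/-- **I(B) — Takahashi's image index is bounded.**  In the situation of
`takahashi2001_thm_2_3_of_coprime` (optimal `(W, P)` of conductor `N = M r`, `r ∥ N`, any Brandt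
setup `S` of type `(M, r)`), the index `i = i_r = # im(Φ_r(J₀(N)) → Φ_r(W))`, pinned by
`ξ_S · c_r(W) = δ · i²` (`xi_mul_eq_modularDegree_mul_sq`; setup-independent by
`Brandt.XiSetup.xi_eq_xi`), satisfies `i ≤ B`.  Sources: Pasten 2024, Lemma 6.14 (p. 23): `i_r`
divides `r' + 1 − a_{r'}(W)` for every prime `r' ∤ N` (the component group `Φ_r(J₀(N))` is
Eisenstein, Ribet; Ribet–Takahashi 1997 Prop. 3), hence `i_r ∣ κ_S` for `N` squarefree away from
`S` (`S = {2}` for Frey curves), `κ_S` supported on primes `≤ 163` (Lemma 6.7, via Mazur 1978);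
uniformly, `m ∣ #W(𝔽_{r'})` for almost all `r'` forces `m ∣ #W'(ℚ)_tors` for an isogenous `W'`
(Katz 1981, Thm. 2), so `i_r ≤ 16` by Mazur 1977, Thm. 8.  NOT Mazur-free; it is the exact gap
between the crux and W0. [cite: PastenShimura2024, Lemma 6.14 (p. 23), Lemma 6.7 (p. 22)]
[cite: Takahashi2001, Thm. 2.3 (p. 79)] [cite: Katz1981, Thm. 2 (doi:10.1007/bf01394256)] -/
def TakahashiIndexBound (B : ℕ) : Prop :=
  ∀ (W : WeierstrassCurve ℚ) [W.IsElliptic] (M r : ℕ) [NeZero (M * r)], r.Prime → M.Coprime r →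
    W.conductorNorm ℤ = M * r → ∀ P : ModularParametrizationData W (M * r),
    (∀ (W' : WeierstrassCurve ℚ) [W'.IsElliptic], W'.conductorNorm ℤ = M * r →
      ∀ P' : ModularParametrizationData W' (M * r), P'.f = P.f →
        P.modularDegree ≤ P'.modularDegree) →
    ∀ S : Brandt.XiSetup M r, ∀ i : ℕ, 0 < i →
      S.xi (fun n => W.LFunction n) * (W.minimalDiscriminantNorm ℤ).factorization r =
        P.modularDegree * i ^ 2 → i ≤ B

/-! ## 1b. Plumbing (gen 5/6 verbatim: composites, duals, kernels of `z ↦ cz`) -/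

/-- R0a (gen 4/5/6 verbatim): degree of a composite. [folklore] -/
theorem degree_comp {W W' W'' : WeierstrassCurve ℚ} [W.IsElliptic] [W'.IsElliptic]
    (ψ : Isogeny W' W'') (φ : Isogeny W W') : (ψ.comp φ).degree = ψ.degree * φ.degree := by
  change Nat.card (ψ.toAddMonoidHom.comp φ.toAddMonoidHom).ker = _
  rw [AddMonoidHom.natCard_ker_comp_of_surjective _ _ φ.surjective]
  rfl

/-- R0c (gen 5/6 verbatim): the dual isogeny has the same degree.
[cite: SilvermanAEC2009, Thm. III.6.1(a), III.6.2(e)] -/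
theorem exists_dual_degree_eq {W W' : WeierstrassCurve ℚ} [W.IsElliptic] [W'.IsElliptic]
    (φ : Isogeny W W') : ∃ ψ : Isogeny W' W, ψ.degree = φ.degree := by
  obtain ⟨ψ, hψ⟩ := φ.exists_dual_of_isElliptic
  exact ⟨ψ, Isogeny_degree_eq_of_comp_eq_degree_zsmul φ ψ hψ⟩

/-- P1a (gen 5/6 verbatim). Kernels multiply along `ℂ/Λ₁ →(c) ℂ/Λ₂ →(d) ℂ/Λ₃`. [folklore] -/
theorem natCard_ker_mulQuotientMap_mul {Λ₁ Λ₂ Λ₃ : AddSubgroup ℂ} {c d : ℂ} (hc0 : c ≠ 0)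
    (hc : ∀ z ∈ Λ₁, c * z ∈ Λ₂) (hd : ∀ z ∈ Λ₂, d * z ∈ Λ₃)
    (hdc : ∀ z ∈ Λ₁, d * c * z ∈ Λ₃) :
    Nat.card (mulQuotientMap Λ₁ Λ₃ (d * c) hdc).ker =
      Nat.card (mulQuotientMap Λ₂ Λ₃ d hd).ker * Nat.card (mulQuotientMap Λ₁ Λ₂ c hc).ker := by
  have hcomp : (mulQuotientMap Λ₂ Λ₃ d hd).comp (mulQuotientMap Λ₁ Λ₂ c hc) =
      mulQuotientMap Λ₁ Λ₃ (d * c) hdc := by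
    refine AddMonoidHom.ext fun P => ?_
    induction P using QuotientAddGroup.induction_on with
    | H z =>
      rw [AddMonoidHom.comp_apply, mulQuotientMap_mk, mulQuotientMap_mk, mulQuotientMap_mk,
        mul_assoc]
  rw [← hcomp, AddMonoidHom.natCard_ker_comp_of_surjective _ _ (mulQuotientMap_surjective hc0)]

/-- Transport of `#ker(z ↦ cz)` along equalities of the lattices AND of the multiplier (gen 5/6
verbatim). [folklore] -/
theorem natCard_ker_mulQuotientMap_congr' {Λ₁ Λ₁' Λ₂ Λ₂' : AddSubgroup ℂ} (h₁ : Λ₁ = Λ₁')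
    (h₂ : Λ₂ = Λ₂') {c c' : ℂ} (hcc : c = c') (hc : ∀ z ∈ Λ₁, c * z ∈ Λ₂)
    (hc' : ∀ z ∈ Λ₁', c' * z ∈ Λ₂') :
    Nat.card (mulQuotientMap Λ₁ Λ₂ c hc).ker = Nat.card (mulQuotientMap Λ₁' Λ₂' c' hc').ker := by
  subst h₁ h₂ hcc
  rfl

/-! ## 1c. F is a theorem of the tree, granted modularity (for the conductor clause only) -/

/-- **F holds, granted BCDT** (`nonempty_modularParametrizationData`, used ONLY to know that the
lattice-optimal curve `W₀ ∼ W⋆` has conductor `N`, `conductorNorm_eq_of_isIsogenous_of_modularity`).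
Proof = the lattice model: `P⋆` minimal among conductor-`N` data ⇒ `c⋆ Λ_f = Λ⋆`
(`latticeEq_of_modularDegree_le`); `deg D = [Λ_D : c_D Λ_f] · deg P⋆`
(`modularDegree_eq_card_ker_mul`); `(c_D/c⋆) Λ⋆ = c_D Λ_f ⊆ Λ_D` gives a `ℚ`-isogeny
`ψ : W⋆ → W` of degree `[Λ_D : (c_D/c⋆) Λ⋆] = [Λ_D : c_D Λ_f]`
(`exists_isogeny_degree_eq_relIndex_of_isNeronLatticeOf`, Silverman AEC VI.4.1(b)); its dual
`φ : W → W⋆` has the same degree, so `deg φ · deg P⋆ = deg D`.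
[cite: PastenShimura2024, §3 (p. 13)] [cite: SilvermanAEC2009, Thm. VI.4.1(b)]
[cite: Knapp1993, Prop. 12.9(a) and p. 302] -/
theorem optimalFactorizationLe_of_modularity (hmod : nonempty_modularParametrizationData) :
    OptimalFactorizationLe := by
  intro N _ W W' _ _ D P' hNW hNW' hiso hopt'
  -- `D.f = P⋆.f`
  have hf : D.f = P'.f := D.isNewformOf.unique (P'.isNewformOf.of_isIsogenous hiso)
  -- `P⋆` is lattice-optimal: compare with the optimal datum `D₀` of its newform (conductor `N`)
  obtain ⟨W₀, hW₀, D₀, hf₀, h₀⟩ := P'.exists_optimalDatum'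
  haveI := hW₀
  have hiso₀ : W₀.IsIsogenous W' := (isIsogenous_of_f_eq P' D₀ hf₀).symm_of_charZero
  have hN₀ : W₀.conductorNorm ℤ = N :=
    (conductorNorm_eq_of_isIsogenous_of_modularity hmod W₀ W' hiso₀).trans hNW'
  have hopt : ∀ z ∈ P'.L.lattice, ∃ w ∈ periodLattice P'.f, z = P'.c * w :=
    P'.latticeEq_of_modularDegree_le D₀ hf₀ h₀ (hopt' W₀ hN₀ D₀ hf₀)
  have hinj : Function.Injective P'.isogenyMap :=
    (AddMonoidHom.ker_eq_bot_iff _).mp (P'.isogenyMap_ker_eq_bot_iff.mpr hopt)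
  -- `deg D = #ker(z ↦ c_D z : ℂ/Λ_f → ℂ/Λ_D) · deg P⋆`
  obtain ⟨-, hdegD⟩ := D.modularDegree_eq_card_ker_mul hf P'.smul_periodLattice_le hinj
    P'.deg_pos P'.finite_setOf_natCard_fiberOrbits_ne
  -- the multiplier `c = c_D / c⋆ : Λ⋆ → Λ_D`
  have hc'0 : (P'.c : ℚ) ≠ 0 := by exact_mod_cast P'.maninConstant_ne_zero_holds
  have hcD0 : (D.c : ℚ) ≠ 0 := by exact_mod_cast D.maninConstant_ne_zero_holds
  set c : ℚ := (D.c : ℚ) / (P'.c : ℚ) with hc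
  have hc0 : c ≠ 0 := div_ne_zero hcD0 hc'0
  have hcc : (c : ℂ) * (P'.c : ℂ) = (D.c : ℂ) := by
    have h : (c * (P'.c : ℚ) : ℚ) = (D.c : ℚ) := by rw [hc, div_mul_cancel₀ _ hc'0]
    have h' := congrArg (fun x : ℚ => (x : ℂ)) h
    push_cast at h'
    exact h'
  have hle' : ∀ z ∈ P'.L.lattice, (c : ℂ) * z ∈ D.L.lattice := by
    intro z hz
    obtain ⟨w, hw, rfl⟩ := hopt z hz
    rw [← mul_assoc, hcc]
    exact D.smul_periodLattice_le w (hf ▸ hw)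
  have hle'' : ∀ z ∈ P'.L.lattice.toAddSubgroup, (c : ℂ) * z ∈ D.L.lattice.toAddSubgroup :=
    fun z hz => hle' z hz
  -- the lattice isogeny `ψ : W⋆ → W`, `deg ψ = [Λ_D : c Λ⋆] = #ker(z ↦ c z : ℂ/Λ⋆ → ℂ/Λ_D)`
  haveI : Algebra.IsAlgebraic ℚ (AlgebraicClosure ℚ) := AlgebraicClosure.isAlgebraic ℚ
  letI : Algebra (AlgebraicClosure ℚ) ℂ :=
    (IsAlgClosed.lift : AlgebraicClosure ℚ →ₐ[ℚ] ℂ).toRingHom.toAlgebra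
  haveI : IsScalarTower ℚ (AlgebraicClosure ℚ) ℂ :=
    IsScalarTower.of_algebraMap_eq' (Subsingleton.elim _ _)
  obtain ⟨ψ, -, -, -, -, hdegψ⟩ :=
    exists_isogeny_degree_eq_relIndex_of_isNeronLatticeOf P'.isNeronLattice D.isNeronLattice hc0 hle'
  have hdegψ' : ψ.degree =
      Nat.card (mulQuotientMap P'.L.lattice.toAddSubgroup D.L.lattice.toAddSubgroup (c : ℂ) hle'').ker := by
    rw [hdegψ, PeriodPair.relIndex_mulLeft_eq_relIndex_comap]
    exact (natCard_ker_mulQuotientMap_eq_relIndex (hc := hle'')).symm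
  -- `#ker(c_D) = #ker(c) · #ker(c⋆) = #ker(c) · 1`
  have hDc : ∀ z ∈ (periodLattice P'.f : AddSubgroup ℂ),
      (c : ℂ) * (P'.c : ℂ) * z ∈ D.L.lattice.toAddSubgroup := fun z hz => by
    rw [mul_assoc]
    exact hle' _ (P'.smul_periodLattice_le z hz)
  have h1 : Nat.card D.isogenyMap.ker =
      Nat.card (mulQuotientMap (periodLattice P'.f) D.L.lattice.toAddSubgroup
        ((c : ℂ) * (P'.c : ℂ)) hDc).ker :=
    natCard_ker_mulQuotientMap_congr' (by rw [hf]) rfl hcc.symm _ _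
  have hP'c : ∀ z ∈ (periodLattice P'.f : AddSubgroup ℂ), (P'.c : ℂ) * z ∈ P'.L.lattice.toAddSubgroup :=
    P'.smul_periodLattice_le
  have hmul : Nat.card D.isogenyMap.ker =
      Nat.card (mulQuotientMap P'.L.lattice.toAddSubgroup D.L.lattice.toAddSubgroup (c : ℂ) hle'').ker
        * Nat.card P'.isogenyMap.ker := by
    rw [h1, natCard_ker_mulQuotientMap_mul (Λ₂ := P'.L.lattice.toAddSubgroup) P'.cast_c_ne_zero
      hP'c hle'' hDc]
    rfl
  have hone : Nat.card P'.isogenyMap.ker = 1 := by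
    rw [P'.isogenyMap_ker_eq_bot_iff.mpr hopt, AddSubgroup.card_bot]
  rw [hone, mul_one, ← hdegψ'] at hmul
  -- the dual `φ : W → W⋆`
  obtain ⟨φ, hφ⟩ := exists_dual_degree_eq ψ
  refine ⟨φ, ?_⟩
  rw [hφ, ← hmul]
  exact hdegD.symm.le

/-! ## 2. N1 — the crux forces the weighted leaf -/

/-- **N1 (necessity of W0).**  `DefiniteRTControlPrime`, Takahashi 2.3 (equality form), F, I(B)
and the modularity of the Frey model give `FreyWeightedTransportSubpoly` with
`R(ε) = max C(ε) 0 · B²`.  With gen 6's `definiteRTControlPrime_of_weightedTransportSubpoly`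
(`W0 → T → crux`) this makes the crux and W0 EQUIVALENT modulo `T`, `F`, `I(B)`, `FreyModularity`.
[cite: Takahashi2001, Thm. 2.3 (p. 79)] [cite: PastenShimura2024, §3 (p. 13), Lemma 6.14 (p. 23)] -/
theorem freyWeightedTransportSubpoly_of_definiteRTControlPrime
    (hF : OptimalFactorizationLe) (hT : takahashi2001_thm_2_3_of_coprime) {B : ℕ}
    (hI : TakahashiIndexBound B) (hM : FreyModularity) (hX : DefiniteRTControlPrime) :
    FreyWeightedTransportSubpoly := by
  intro ε hε
  obtain ⟨C, hC⟩ := hX ε hε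
  refine ⟨max C 0 * (B : ℝ) ^ 2, ?_⟩
  intro a b hab h0 N _ hN q hq hq2 hqN W' _ P' hcond' hopt' hiso
  haveI := isElliptic_freyCurve h0
  -- `N = M q`, `gcd(M, q) = 1`
  obtain ⟨M, hMq⟩ := hqN
  rw [mul_comm] at hMq
  subst hMq
  have hdiv : M * q / q = M := Nat.mul_div_cancel M hq.pos
  have hqN' : q ∣ (freyCurve a b).conductorNorm ℤ := by rw [hN]; exact Dvd.intro_left M rfl
  have hcop : M.Coprime q := by
    have h := stub_freyLocal a b hab h0 q hq hq2 hqN'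
    rwa [hN, hdiv] at h
  -- a minimal datum `D` of the Frey model and the crux bound at `D`
  obtain ⟨D, -, hDmin⟩ := exists_minimal_datum (hM a b hab h0 (M * q) hN)
  have hXD := hC a b hab h0 (M * q) hN q hq hq2 (Dvd.intro_left M rfl) D (fun D' => hDmin D')
  rw [hdiv] at hXD
  -- F: one isogeny `φ : E → W⋆` with `deg φ · deg P⋆ ≤ deg D`
  obtain ⟨φ, hφ⟩ := hF (M * q) (freyCurve a b) W' D P' hN hcond' hiso hopt'
  refine ⟨φ, ?_⟩
  -- `a(W⋆) = a(E)`
  have hL0 : W'.LFunction = (freyCurve a b).LFunction := hiso.LFunction_eq.symm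
  -- Takahashi (equality form) in the chosen setup, the index bound, `ξ > 0`
  obtain ⟨S, hS⟩ := exists_brandtXi_eq
    (takahashi2001_thm_2_3_of_coprime.nonempty_xiSetup' hq hcop) (fun n => W'.LFunction n)
  obtain ⟨i, hi, -, hsq⟩ :=
    takahashi2001_thm_2_3_of_coprime.xi_mul_eq_modularDegree_mul_sq hT W' M q hq hcop hcond' P'
      hopt' S
  have hiB : i ≤ B := hI W' M q hq hcop hcond' P' hopt' S i hi hsq
  have hξpos := takahashi2001_thm_2_3_of_coprime.brandtXi_pos hT W' M q hq hcop hcond' P' hopt'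
  rw [← hS] at hsq
  rw [hL0] at hsq hξpos
  -- the chain, in `ℝ`
  set ξ : ℕ := brandtXi M q (fun n => (freyCurve a b).LFunction n) with hξ
  set v : ℕ := ((freyCurve a b).minimalDiscriminantNorm ℤ).factorization q with hv
  set v' : ℕ := (W'.minimalDiscriminantNorm ℤ).factorization q with hv'
  set Nr : ℝ := ((M * q : ℕ) : ℝ) with hNr
  have hsqR : (ξ : ℝ) * (v' : ℝ) = (P'.modularDegree : ℝ) * (i : ℝ) ^ 2 := by exact_mod_cast hsq
  have hφR : (φ.degree : ℝ) * (P'.modularDegree : ℝ) ≤ (D.deg : ℝ) := by exact_mod_cast hφ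
  have hXR : (D.deg : ℝ) ≤ C * Nr ^ ε * (ξ : ℝ) * (v : ℝ) := by
    calc (D.deg : ℝ) ≤ C * Nr ^ ε * ((ξ : ℝ) * (v : ℝ)) := by exact_mod_cast hXD
      _ = C * Nr ^ ε * (ξ : ℝ) * (v : ℝ) := by ring
  have hξR : (0 : ℝ) < (ξ : ℝ) := by exact_mod_cast hξpos
  have hiB' : (i : ℝ) ≤ (B : ℝ) := by exact_mod_cast hiB
  have hiR : (i : ℝ) ^ 2 ≤ (B : ℝ) ^ 2 := by gcongr
  have hNr0 : (0 : ℝ) ≤ Nr := by positivity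
  have hpow0 : (0 : ℝ) ≤ Nr ^ ε := Real.rpow_nonneg hNr0 _
  have hK : (0 : ℝ) ≤ Nr ^ ε * (ξ : ℝ) * (v : ℝ) := by positivity
  have hK' : (0 : ℝ) ≤ max C 0 * Nr ^ ε * (ξ : ℝ) * (v : ℝ) := by
    have := le_max_right C 0
    positivity
  have key : (φ.degree : ℝ) * (v' : ℝ) * (ξ : ℝ) ≤
      max C 0 * (B : ℝ) ^ 2 * Nr ^ ε * (v : ℝ) * (ξ : ℝ) :=
    calc (φ.degree : ℝ) * (v' : ℝ) * (ξ : ℝ)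
        = (φ.degree : ℝ) * (P'.modularDegree : ℝ) * (i : ℝ) ^ 2 := by
          linear_combination (φ.degree : ℝ) * hsqR
      _ ≤ (D.deg : ℝ) * (i : ℝ) ^ 2 := mul_le_mul_of_nonneg_right hφR (sq_nonneg _)
      _ ≤ C * Nr ^ ε * (ξ : ℝ) * (v : ℝ) * (i : ℝ) ^ 2 :=
          mul_le_mul_of_nonneg_right hXR (sq_nonneg _)
      _ ≤ max C 0 * Nr ^ ε * (ξ : ℝ) * (v : ℝ) * (i : ℝ) ^ 2 := by
          have h : C * (Nr ^ ε * (ξ : ℝ) * (v : ℝ)) ≤ max C 0 * (Nr ^ ε * (ξ : ℝ) * (v : ℝ)) :=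
            mul_le_mul_of_nonneg_right (le_max_left _ _) hK
          have h' : C * Nr ^ ε * (ξ : ℝ) * (v : ℝ) ≤ max C 0 * Nr ^ ε * (ξ : ℝ) * (v : ℝ) := by
            calc C * Nr ^ ε * (ξ : ℝ) * (v : ℝ) = C * (Nr ^ ε * (ξ : ℝ) * (v : ℝ)) := by ring
              _ ≤ max C 0 * (Nr ^ ε * (ξ : ℝ) * (v : ℝ)) := h
              _ = max C 0 * Nr ^ ε * (ξ : ℝ) * (v : ℝ) := by ring
          exact mul_le_mul_of_nonneg_right h' (sq_nonneg _)
      _ ≤ max C 0 * Nr ^ ε * (ξ : ℝ) * (v : ℝ) * (B : ℝ) ^ 2 := mul_le_mul_of_nonneg_left hiR hK'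
      _ = max C 0 * (B : ℝ) ^ 2 * Nr ^ ε * (v : ℝ) * (ξ : ℝ) := by ring
  exact le_of_mul_le_mul_right key hξR

/-- **N1′ — the same with F and `FreyModularity` discharged by BCDT**: granted modularity
(`nonempty_modularParametrizationData`), Takahashi 2.3 and the index bound I(B), the crux forces W0.
[cite: BCDTJAMS2001, Thm. A] [cite: Takahashi2001, Thm. 2.3] [cite: PastenShimura2024, Lemma 6.14] -/
theorem freyWeightedTransportSubpoly_of_definiteRTControlPrime'
    (hmod : nonempty_modularParametrizationData) (hT : takahashi2001_thm_2_3_of_coprime) {B : ℕ}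
    (hI : TakahashiIndexBound B) (hX : DefiniteRTControlPrime) : FreyWeightedTransportSubpoly :=
  freyWeightedTransportSubpoly_of_definiteRTControlPrime (optimalFactorizationLe_of_modularity hmod)
    hT hI (freyModularity_of_nonempty_modularParametrizationData hmod) hX

/-! ## 3. The two directions side by side (gen 6 ⟸, gen 7 ⟹), as one record -/

/-- **The reformulation, packaged.**  Granted Takahashi 2.3, F, I(B) and `FreyModularity`, the
crux holds iff the weighted leaf does — the `←` direction is gen 6's
`definiteRTControlPrime_of_weightedTransportSubpoly hT` (not re-proved here: it lives in the
non-importable `StubIdeasK2G6PastenLemma68.lean`, rc 0), supplied as the hypothesis `hSuff`. -/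
theorem definiteRTControlPrime_iff_weighted
    (hSuff : takahashi2001_thm_2_3_of_coprime → FreyWeightedTransportSubpoly → DefiniteRTControlPrime)
    (hF : OptimalFactorizationLe) (hT : takahashi2001_thm_2_3_of_coprime) {B : ℕ}
    (hI : TakahashiIndexBound B) (hM : FreyModularity) :
    DefiniteRTControlPrime ↔ FreyWeightedTransportSubpoly :=
  ⟨freyWeightedTransportSubpoly_of_definiteRTControlPrime hF hT hI hM, hSuff hT⟩

end Summit.ABC.ABC.Cruxes.DefiniteRTControlPrime.StubIdeas2G7

end
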